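import Literature.Geometry.Riemannian.ShrinkerEntropy
import HarnessLib

/-!
# Li–Wang: the optimal logarithmic Sobolev constant of a Ricci shrinker at all scales (named fact)

Topic `Geometry/Riemannian`; companion of `ShrinkerEntropy.lean` (named fact `CarrilloNi2009_shrinkerLSI`:
the sharp LSI of a complete gradient shrinker AT SCALE `τ = 1`, `𝒲(g, ψ, 1) ≥ log Θ`). Filed for the crux
`EntropyRung.ConicalGap` (item `stmt-SmoothPoincare4-16589`, route SmoothPoincare4/EntropyRung), whose line
`Sketch` uses it through the self-similar test function `f/τ + log h(τ)` (Summits-side files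
`EntropyRungConicalGapSelfSimilarEntropy.lean`, `EntropyRungConicalGapConeFence.lean`: the cone fence
`Θ ≤ AVR · e^ρ`).

## Source, as printed

Y. Li, B. Wang, *Heat kernel on Ricci shrinkers*, Calc. Var. Partial Differential Equations 59 (2020),
no. 194 = arXiv:1901.05691 [LiWang2020], read in the arXiv text:
* (1.1)–(1.3), p. 3: "A Ricci shrinker is a triple `(Mⁿ, g, f)` of smooth manifold `Mⁿ`, Riemannian metric
  `g` and a smooth function `f` satisfying `Rc + Hess f = ½ g`. By a normalization of `f`, we can assume
  that `R + |∇f|² = f`, `∫_M e^{-f} (4π)^{-n/2} dV = e^{μ}`, where `μ` is the functional of Perelman"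
  (completeness of `g` is the paper's standing assumption: §2 uses the flow of `∇f/(1−t)` for all
  `t < 1` and Lemma 2.1 = Chen / Cao–Zhou / Haslhofer–Müller);
* (4.3)–(4.4), p. 14: "`μ(g, τ) = inf {W̄(g, u, τ) | u ∈ W^{1,2}_*(M)}`,
  `W̄(g, u, τ) = ∫ τ(4|∇u|² + Ru²) − u² log u² dV − (n + (n/2) log(4πτ)) ∫ u² dV`,
  `W^{1,2}_*(M) = {u | ∫_M |∇u|² dV < ∞, ∫_M u² dV = 1 and ∫_M d²(p, ·) u² dV < ∞}`";
* (5.1), p. 18: "`μ = μ(g) := log ∫ e^{-f} (4π)^{-n/2} dV`";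
* **Theorem 1.1** (p. 3) = **Proposition 5.9** with **Lemma 5.10** (p. 20): "Let `(Mⁿ, p, g, f)` be a Ricci
  shrinker. Then `μ(g, τ)` is a continuous function for `τ > 0` such that `μ(g, τ)` is decreasing for
  `τ ≤ 1` and increasing for `τ ≥ 1`. In particular, we have `ν(g) := inf_{τ > 0} μ(g, τ) = μ(g)`."
  ("Note that the same result has already been proved for compact Ricci shrinkers in Proposition 9.5 of
  [LLW18]"; the proof for `τ < 1` runs the conjugate heat equation on the shrinker space-time, Lemma 5.10,
  and for `τ > 1` the heat equation, Lemma 5.11, after the heat-kernel theory of §§2–4.)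

## Rendering

Over the vocabulary of `PerelmanEntropy.lean` / `ShrinkerEntropy.lean` and in the SHAPE of clause (ii) of
`CarrilloNi2009_shrinkerLSI` (its case `τ = 1`): a connected manifold modelled on `ℝⁿ`, a complete Riemannian
`g` (closed `g.riemEDist`-balls compact) with its Levi-Civita connection, a smooth `f` with
`Ric + Hess f = g/2` and `R + |∇f|² = f`; write `log Θ := log ((4π)^{-n/2} ∫ e^{-f} dV)` (`= μ` of (5.1)).
For a scale `τ > 0` and a SMOOTH `ψ` compatible at scale `τ` (`∫ u dV = 1`, `u = (4πτ)^{-n/2} e^{-ψ}`,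
`g.IsEntropyCompatible ψ τ`), put `u = v²`: then `4|∇v|² = |∇ψ|² u`, `∫ v² = 1`, and
`W̄(g, v, τ) = ∫ [τ(|∇ψ|² + R) + ψ − n] u dV = 𝒲(g, ψ, τ)` (the tree's Bochner `g.wEntropy g.leviCivita ψ τ`)
whenever the `𝒲`-integrand is integrable; `v ∈ W^{1,2}_*` reads "`|∇ψ|² u` integrable and `d(o, ·)² u`
integrable for some `o`" (for some `o` iff for the minimum point `p`: `d(p, ·)² ≤ 2d(o, ·)² + 2d(o, p)²` and
`∫ u = 1`). For such `ψ` the printed `μ(g, τ) ≥ μ` gives `𝒲(g, ψ, τ) ≥ log Θ`. The fact asserts exactly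
this, for every `τ > 0`; the class quantified (smooth `ψ` with integrable `𝒲`-integrand, finite Fisher
information and finite second moment) is contained in the printed `W^{1,2}_*`, so the fact is a consequence
of the printed theorem (weaker: continuity and monotonicity of `μ(g, ·)` are not asserted). At `τ = 1` it is
implied by `CarrilloNi2009_shrinkerLSI` clause (ii) restricted to finite Fisher information. Empty `M` is
excluded by `[ConnectedSpace M]`. Deep theorem (heat kernel on the shrinker space-time); NOT proved here
(D-0014): users take `(h : LiWang2020_shrinkerLSI_allScales)`.

## References

* [LiWang2020] Y. Li, B. Wang, Calc. Var. PDE 59 (2020) no. 194 (arXiv:1901.05691): Thm. 1.1, (1.1)–(1.3),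
  §4 (4.3)–(4.4), (5.1), Prop. 5.9, Lemmas 5.10–5.11 (held; read pp. 3, 7, 14, 18–20 of the text).
* [CarrilloNi2009] J. A. Carrillo, L. Ni, Comm. Anal. Geom. 17 (2009) 721–753: Thm. 1.1, §4 (scale `1`).
-/

noncomputable section

open Bundle Set Module Filter MeasureTheory Manifold
open scoped ContDiff Topology ENNReal NNReal

namespace Literature.Geometry.Riemannian

open Lorentzian

/-- **Li–Wang 2020, Thm. 1.1 / Prop. 5.9 — the optimal logarithmic Sobolev constant of a complete gradient
shrinking Ricci soliton is `log Θ` at ALL scales** ("`ν(g) := inf_{τ>0} μ(g, τ) = μ = μ(g, 1)`"), in the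
`𝒲`-form over smooth densities: on a connected manifold modelled on `ℝⁿ` with a complete Riemannian metric
`g` (closed `g`-balls compact, Levi-Civita connection) and a smooth `f` with `Ric + Hess f = g/2`,
`R + |∇f|² = f`, for every `τ > 0` and every smooth `ψ` compatible at scale `τ`
(`∫ (4πτ)^{-n/2} e^{-ψ} dV = 1`) whose density `u` has finite second moment (`∫ d(o, x)² u < ∞` for some
`o`), finite Fisher information (`|∇ψ|² u` integrable) and integrable `𝒲`-integrand — i.e. `√u` lies in the
printed class `W^{1,2}_*` — one has `log ((4π)^{-n/2} ∫ e^{-f} dV) ≤ 𝒲(g, ψ, τ)`. The case `τ = 1` is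
Carrillo–Ni's Thm. 1.1 (ii) (`CarrilloNi2009_shrinkerLSI`). Named fact (D-0014), see the module docstring
for the rendering. [cite: LiWang2020, Thm. 1.1 and Prop. 5.9] -/
def LiWang2020_shrinkerLSI_allScales : Prop :=
  ∀ (n : ℕ) (M : Type) [TopologicalSpace M] [T2Space M] [SecondCountableTopology M]
    [ChartedSpace (EuclideanSpace ℝ (Fin n)) M] [IsManifold (𝓡 n) ∞ M] [ConnectedSpace M]
    [T3Space M] [MeasurableSpace M] [BorelSpace M]
    (g : PseudoRiemannianMetric (𝓡 n) ∞ (EuclideanSpace ℝ (Fin n)) (TangentSpace (𝓡 n) : M → Type _))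
    [g.HasLeviCivita] (f : M → ℝ), g.IsRiemannian →
      (∀ (x : M) (r : NNReal), IsCompact {y : M | g.riemEDist x y ≤ r}) →
      ContMDiff (𝓡 n) 𝓘(ℝ, ℝ) ∞ f →
      (∀ (x : M) (X Y : TangentSpace (𝓡 n) x),
        g.ricci x X Y + g.hessian f x X Y = (1 / 2 : ℝ) * g.val x X Y) →
      (∀ x : M, g.scalarCurvature x + g.gradSq f x = f x) →
      ∀ τ : ℝ, 0 < τ → ∀ ψ : M → ℝ, ContMDiff (𝓡 n) 𝓘(ℝ, ℝ) ∞ ψ → g.IsEntropyCompatible ψ τ →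
        (∃ o : M, Integrable (fun x ↦ (g.riemEDist o x).toReal ^ 2 * entropyDensity n ψ τ x)
          g.riemVolume) →
        Integrable (fun x ↦ g.gradSq ψ x * entropyDensity n ψ τ x) g.riemVolume →
        Integrable (fun x ↦ (τ * (g.scalarCurvature x + g.gradSq ψ x) + ψ x - n) *
          entropyDensity n ψ τ x) g.riemVolume →
        Real.log ((4 * Real.pi) ^ (-(n : ℝ) / 2) * ∫ x, Real.exp (-f x) ∂g.riemVolume) ≤
          g.wEntropy g.leviCivita ψ τ

namespace LiWang2020_shrinkerLSI_allScales

variable {n : ℕ} {M : Type} [TopologicalSpace M] [T2Space M] [SecondCountableTopology M]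
  [ChartedSpace (EuclideanSpace ℝ (Fin n)) M] [IsManifold (𝓡 n) ∞ M] [ConnectedSpace M]
  [T3Space M] [MeasurableSpace M] [BorelSpace M]
  {g : PseudoRiemannianMetric (𝓡 n) ∞ (EuclideanSpace ℝ (Fin n)) (TangentSpace (𝓡 n) : M → Type _)}
  [g.HasLeviCivita] {f : M → ℝ}

/-- **`log Θ ≤ μ(g, τ)` restricted to the fact's class**, in `EReal`: for every `τ > 0` and every smooth
compatible `ψ` with finite second moment, finite Fisher information and integrable `𝒲`-integrand,
`log Θ ≤ 𝒲(g, ψ, τ)` as extended reals (the printed "`μ(g, τ) ≥ μ`", read density by density).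
[cite: LiWang2020, Thm. 1.1 and Prop. 5.9] -/
theorem log_le_wEntropy (h : LiWang2020_shrinkerLSI_allScales) (hg : g.IsRiemannian)
    (hc : ∀ (x : M) (r : NNReal), IsCompact {y : M | g.riemEDist x y ≤ r})
    (hf : ContMDiff (𝓡 n) 𝓘(ℝ, ℝ) ∞ f)
    (hsol : ∀ (x : M) (X Y : TangentSpace (𝓡 n) x),
      g.ricci x X Y + g.hessian f x X Y = (1 / 2 : ℝ) * g.val x X Y)
    (hnorm : ∀ x : M, g.scalarCurvature x + g.gradSq f x = f x) {τ : ℝ} (hτ : 0 < τ) {ψ : M → ℝ}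
    (hψ : ContMDiff (𝓡 n) 𝓘(ℝ, ℝ) ∞ ψ) (hcompat : g.IsEntropyCompatible ψ τ)
    (hmom : ∃ o : M, Integrable (fun x ↦ (g.riemEDist o x).toReal ^ 2 * entropyDensity n ψ τ x)
      g.riemVolume)
    (hfisher : Integrable (fun x ↦ g.gradSq ψ x * entropyDensity n ψ τ x) g.riemVolume)
    (hint : Integrable (fun x ↦ (τ * (g.scalarCurvature x + g.gradSq ψ x) + ψ x - n) *
      entropyDensity n ψ τ x) g.riemVolume) :
    ((Real.log ((4 * Real.pi) ^ (-(n : ℝ) / 2) * ∫ x, Real.exp (-f x) ∂g.riemVolume) : ℝ) : EReal) ≤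
      ((g.wEntropy g.leviCivita ψ τ : ℝ) : EReal) :=
  EReal.coe_le_coe_iff.2 (h n M g f hg hc hf hsol hnorm τ hτ ψ hψ hcompat hmom hfisher hint)

end LiWang2020_shrinkerLSI_allScales

end Literature.Geometry.Riemannian

end
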